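import Summits.HodgeConjecture.HodgeConjecture.Theses.PadicSemiregularLift
import Summits.HodgeConjecture.HodgeConjecture.Theorems.PadicSemiregularLiftHodgeAbelianVarietiesStarSeedsEngine
import Literature.AlgebraicGeometry.HodgeTheory.ComplexConjugationHolds

/-!
# `FermatAnchorAssembly` (stmt-HodgeConjecture-14874): what a disproof must contain; load-bearing iffs; free instances

Negative / tightness lemmas of the standing disprover of the crux
`Summit.HodgeConjecture.HodgeConjecture.Theses.PadicSemiregularLift.FermatAnchorAssembly :=
PadicPridhamSemiregularity → FormalLiftingFromClassLifting → FormalVectorBundlesAlgebraize →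
HodgeFermatVarieties` (route `PadicSemiregularLift`, glue node: typed engine P1b/P1a/P3a ⊢ HC for
every complex Fermat hypersurface). All sorry-free and unconditional; none asserts a route item:

* `not_fermatAnchorAssembly_iff` — `¬ crux ↔ (P1b ∧ P1a ∧ P3a) ∧ ¬ HodgeFermatVarieties`: a disproof
  must PROVE the whole typed engine AND refute HC on a Fermat hypersurface
  (`exists_fermat_counterexample_of_not_fermatAnchorAssembly`), hence refute the summit
  (`not_hodgeConjecture_of_not_fermatAnchorAssembly`);
* `fermatAnchorAssembly_iff_hodgeFermatVarieties_of_engine` — given the engine the crux is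
  EQUIVALENT to its consequent `HodgeFermatVarieties` (stmt-HodgeConjecture-1334);
* `without*_iff` — dropping any one engine hypothesis yields a statement equivalent, given the two
  others, to `HodgeFermatVarieties`: no hypothesis is removable short of proving HC(Fermat), and no
  `_false_without_` theorem exists short of refuting it;
* `hodgeConjectureFor_of_dim_le_one`, `hodgeFermatVarieties_iff_two_le` — the consequent is FREE in
  dimension `≤ 1` (no middle codimension over the tree's carriers), so its `∀ n` has content only
  from `n = 2` on (in print from `n = 4` on).

Refuter refuter-cdisprove-stmt-HodgeConjecture-14874-0, 2026-08-16 (full analysis, including the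
picked line `Sketch`: `Cruxes/FermatAnchorAssembly/Disproof.lean`).
-/

-- `Summit.HodgeConjecture.HodgeConjecture.…` is the tree's mandated summit/problem namespace (single-problem summit).
set_option linter.dupNamespace false

namespace Summit.HodgeConjecture.HodgeConjecture.Theorems.FermatAnchorAssemblyNegative

open Literature.AlgebraicGeometry.Motives Literature.AlgebraicGeometry.HodgeTheory
open Summit.HodgeConjecture.HodgeConjecture.Theses.PadicSemiregularLift
open Summit.HodgeConjecture.HodgeConjecture.Cruxes.HodgeAbelianVarieties.InnerFormInvariantSeeds.Engine
  (mem_algebraicClasses_of_extreme)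

/-- **What a disproof is.** The negation of the crux is EXACTLY: the three typed engine statements hold
and HC fails for some complex Fermat hypersurface. [folklore] -/
theorem not_fermatAnchorAssembly_iff :
    ¬ FermatAnchorAssembly ↔
      (PadicPridhamSemiregularity ∧ FormalLiftingFromClassLifting ∧ FormalVectorBundlesAlgebraize) ∧
        ¬ HodgeFermatVarieties := by
  constructor
  · intro h
    by_contra hc
    apply h
    intro h1b h1a h3a
    by_contra hF
    exact hc ⟨⟨h1b, h1a, h3a⟩, hF⟩
  · rintro ⟨⟨h1b, h1a, h3a⟩, hF⟩ h
    exact hF (h h1b h1a h3a)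

/-- **A disproof of the crux yields a counterexample to HC on a Fermat hypersurface** (the witness any
refutation must produce). [folklore] -/
theorem exists_fermat_counterexample_of_not_fermatAnchorAssembly (h : ¬ FermatAnchorAssembly) :
    ∃ (n m : ℕ) (X : SchemeOver ℂ), IsFermatVariety n m X ∧ IsSmoothProjective n X ∧
      ¬ HodgeConjectureFor n X := by
  have hF := (not_fermatAnchorAssembly_iff.1 h).2
  unfold HodgeFermatVarieties at hF
  push Not at hF
  obtain ⟨n, m, X, h1, h2, h3⟩ := hF
  exact ⟨n, m, X, h1, h2, h3⟩

/-- **A disproof of the crux disproves the Hodge conjecture** (the summit statement). [folklore] -/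
theorem not_hodgeConjecture_of_not_fermatAnchorAssembly (h : ¬ FermatAnchorAssembly) :
    ¬ _root_.HodgeConjecture :=
  fun hc => h fun _ _ _ _ _ _ _ hX => hc hX

/-- Given the engine, the crux is EQUIVALENT to its consequent `HodgeFermatVarieties`. [folklore] -/
theorem fermatAnchorAssembly_iff_hodgeFermatVarieties_of_engine (h1b : PadicPridhamSemiregularity)
    (h1a : FormalLiftingFromClassLifting) (h3a : FormalVectorBundlesAlgebraize) :
    FermatAnchorAssembly ↔ HodgeFermatVarieties :=
  ⟨fun h => h h1b h1a h3a, fun h _ _ _ => h⟩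

/-! ### Load-bearing analysis: each engine hypothesis dropped is removable iff HC(Fermat) holds -/

/-- h1b (`PadicPridhamSemiregularity`) dropped: equivalent to the consequent given P1a, P3a. [folklore] -/
theorem withoutPridham_iff (h1a : FormalLiftingFromClassLifting) (h3a : FormalVectorBundlesAlgebraize) :
    (FormalLiftingFromClassLifting → FormalVectorBundlesAlgebraize → HodgeFermatVarieties) ↔
      HodgeFermatVarieties :=
  ⟨fun h => h h1a h3a, fun h _ _ => h⟩

/-- h1a (`FormalLiftingFromClassLifting`) dropped: equivalent to the consequent given P1b, P3a.
[folklore] -/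
theorem withoutFormalLifting_iff (h1b : PadicPridhamSemiregularity)
    (h3a : FormalVectorBundlesAlgebraize) :
    (PadicPridhamSemiregularity → FormalVectorBundlesAlgebraize → HodgeFermatVarieties) ↔
      HodgeFermatVarieties :=
  ⟨fun h => h h1b h3a, fun h _ _ => h⟩

/-- h3a (`FormalVectorBundlesAlgebraize`) dropped: equivalent to the consequent given P1b, P1a.
[folklore] -/
theorem withoutAlgebraization_iff (h1b : PadicPridhamSemiregularity)
    (h1a : FormalLiftingFromClassLifting) :
    (PadicPridhamSemiregularity → FormalLiftingFromClassLifting → HodgeFermatVarieties) ↔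
      HodgeFermatVarieties :=
  ⟨fun h => h h1b h1a, fun h _ _ => h⟩

/-- Refuting any weakening of the crux refutes the Hodge conjecture (so no `_false_without_` theorem
exists short of `¬ HC`). [folklore] -/
theorem not_hodgeConjecture_of_not_without :
    (¬ (FormalLiftingFromClassLifting → FormalVectorBundlesAlgebraize → HodgeFermatVarieties) →
        ¬ _root_.HodgeConjecture) ∧
      (¬ (PadicPridhamSemiregularity → FormalVectorBundlesAlgebraize → HodgeFermatVarieties) →
        ¬ _root_.HodgeConjecture) ∧
      (¬ (PadicPridhamSemiregularity → FormalLiftingFromClassLifting → HodgeFermatVarieties) →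
        ¬ _root_.HodgeConjecture) ∧
      (¬ HodgeFermatVarieties → ¬ _root_.HodgeConjecture) :=
  ⟨fun h hc => h fun _ _ _ _ _ _ hX => hc hX, fun h hc => h fun _ _ _ _ _ _ hX => hc hX,
    fun h hc => h fun _ _ _ _ _ _ hX => hc hX, fun h hc => h fun _ _ _ _ hX => hc hX⟩

/-! ### Degenerate instances of the consequent are free (dimension ≤ 1) -/

/-- HC holds for every smooth projective complex variety of dimension `≤ 1` over the tree's carriers:
there is no middle codimension (`mem_algebraicClasses_of_extreme`) and Hodge models exist
(`nonempty_hodgeModel_holds`). [folklore] -/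
theorem hodgeConjectureFor_of_dim_le_one {n : ℕ} {X : SchemeOver ℂ} (hX : IsSmoothProjective n X)
    (hn : n ≤ 1) : HodgeConjectureFor n X :=
  ⟨nonempty_hodgeModel_holds hX, fun r c _ _ => mem_algebraicClasses_of_extreme hX (by omega) c⟩

/-- **The consequent is equivalent to its restriction to dimension `≥ 2`** (Fermat points and Fermat
curves are free; the Fermat hypothesis is not even used there). [folklore] -/
theorem hodgeFermatVarieties_iff_two_le :
    HodgeFermatVarieties ↔ ∀ (n m : ℕ) (X : SchemeOver ℂ), 2 ≤ n → IsFermatVariety n m X →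
      IsSmoothProjective n X → HodgeConjectureFor n X := by
  refine ⟨fun h n m X _ hF hX => h n m X hF hX, fun h n m X hF hX => ?_⟩
  by_cases hn : 2 ≤ n
  · exact h n m X hn hF hX
  · exact hodgeConjectureFor_of_dim_le_one hX (by omega)

/-- Hence, given the engine, the crux is equivalent to HC for Fermat hypersurfaces of dimension `≥ 2`
only. [folklore] -/
theorem fermatAnchorAssembly_iff_two_le_of_engine (h1b : PadicPridhamSemiregularity)
    (h1a : FormalLiftingFromClassLifting) (h3a : FormalVectorBundlesAlgebraize) :
    FermatAnchorAssembly ↔ ∀ (n m : ℕ) (X : SchemeOver ℂ), 2 ≤ n → IsFermatVariety n m X →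
      IsSmoothProjective n X → HodgeConjectureFor n X :=
  (fermatAnchorAssembly_iff_hodgeFermatVarieties_of_engine h1b h1a h3a).trans hodgeFermatVarieties_iff_two_le

end Summit.HodgeConjecture.HodgeConjecture.Theorems.FermatAnchorAssemblyNegative
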